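import Summits.QuantumFields.BalabanUV.Beta.MixedLetterPacking

/-!
# `BalabanUV.Beta.MixedLetterUnpacking` — binder row D1, MIXED sub-chain «MX4»: **THE ENTRYWISE (BOND-LEVEL) FORM OF an1's TABLE-LEVEL
# MIXED LAW** `hM_an1` (MX2's hypothesis), and the mixed binders from the bond law (β sub-cell, D1 formalisation swarm, leaf-05 gen 7)

HONEST FRAMING (cell charter, verbatim): «discharging BetaPertH makes Balaban's UV stability UNCONDITIONAL — a real
constructive-QFT result; it is NOT the continuum limit and NOT the Clay problem.»
HONEST DEPENDENCY: continuum YM on T⁴ ⇐ BetaPertH ∧ nine spine estimates (0/9 proved); BetaPertH ⇐ (D1) ∧ (D4) ∧ CAP+tail;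
G-an2-4 gates asym, D1 and NE2/3/4.
DERIVED cell leaf ([folklore] unfolding over node 7aρ∕12b `hessKerAt`∕`hessFFAt`∕`linKerAt`∕`mixKerAt`∕`mixFFAt`, an5's `refK`∕`Φ`, an2's
`diagK`∕`ctGen`, leaf-05's MX2 `MixedLetterPacking`, all BY NAME).  No statement of Bałaban's papers, no `[cite:]`, no definition, no `Prop`
fact; BOTH sides of the `iff` are hypothesis SHAPES (nothing is asserted to hold).  Proves NO table identity and NO letter; 0∕4 binders
(hW, hR, D1Tel, D1Rep).  NOT D1, NOT BetaPertH, NOT continuum, NOT Clay.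

## What is here (`d + 1 = 4`, `ρ_c = toSite (ctrOff 4 Lc)`)
* `tableLaw_apply_inl_inl`: the `(inl β, inl β′)` entry of the right-hand side of `hM_an1`, in bond language.
* **`tableLaw_iff_bondLaw`**: MX2's matrix-level hypothesis `hM_an1` ⟺ the scalar identity, for all `α κ u ρ′ w β x β′ z`,
  `mixKerAt ρ_c Lc ρ′ (bref α ρ′ w) (κ, bref α κ u) (β, x) (β′, z) = ε_κ ε_ρ′ · (ε_β ε_β′ · (mixKerAt ρ_c Lc ρ′ w (κ, u) (β, x̄) (β′, z̄)
  + 2·(−[x̄ = u ∧ β = κ ∧ κ = α])·hessKerAt ρ_c Lc ρ′ w (β, x̄) (β′, z̄) + 2·[ρ′ = α]·linKerAt ρ_c Lc ρ′ w (κ, u)·hessKerAt ρ_c Lc ρ′ w (β, x̄) (β′, z̄)))`,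
  `x̄ := bref α β x`, `z̄ := bref α β′ z` (the other entries of both sides vanish: the tables are field–field supported).
* **`mixedBinders_of_bondLaw`**: bond law ∧ `cΛ·Lc⁴ = 2` ⟹ the three mixed binders `(hM₀, hRM₀c, hRM₀p)` (MX2 `mixedBinders_of_tableLaw`);
  `mixKerAt_eq_tTab_cast` (the `ℚ`-table reading, `rfl`).
Provenance: β sub-cell, D1 formalisation swarm, unit b2b-balaban-beta-d1-formalise-leaf-05 gen 7, 2026-08-20 (v1); no existing file touched.
-/

open Literature.MathematicalPhysics.QuantumFieldTheory.Balaban1983to89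
open Literature.MathematicalPhysics.QuantumFieldTheory.Balaban1983to89.Beta
open ExpKernelCalculus (MKer comp)
open AffineAveraging (toSite)
open AveragingContoursRooted (ctrOff)
open AveragingHessianKernelsRooted (hessKerAt hessFFAt hessFFAt_inl_inl hessFFAt_inl_inr hessFFAt_inr linKerAt)
open AveragingMixedJetTables (mixKerAt mixFFAt mixFFAt_inl_inl mixFFAt_inl_inr mixFFAt_inr)
open PolarizationSign (reflSign)
open KernelReflection (refK refK_apply)
open ResolventReflection (bref Φ Φ_r_inl Φ_s_inl)
open OneStepResolventKernel (Fib)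
open SecondOrderResponse (LocStencilFM)
open Summit.QuantumFields.BalabanUV.Beta.TameKernelCalculus
open Summit.QuantumFields.BalabanUV.Beta.BorderedHessian (sgnK diagK ctGen ctGen_inl comp_diagK_left)
open Summit.QuantumFields.BalabanUV.Beta.SecondOrderLetterLevels (MixedPrim)
open Summit.QuantumFields.BalabanUV.Beta.MixedLetterPacking (RMof mixedBinders_of_tableLaw)

namespace Summit.QuantumFields.BalabanUV.Beta.MixedLetterUnpacking

noncomputable section

variable {Lc : ℕ}

open Classical in
/-- [folklore] **THE `(inl β, inl β′)` ENTRY OF THE RIGHT-HAND SIDE OF `hM_an1`** in bond language. -/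
theorem tableLaw_apply_inl_inl (α κ : Fin 4) (u : Fin 4 → ℤ) (ρ' : Fin 4) (w : Fin 4 → ℤ) (β : Fin 4) (x : Fin 4 → ℤ)
    (β' : Fin 4) (z : Fin 4 → ℤ) :
    ((reflSign α κ * reflSign α ρ') • refK (Φ Lc α)
        (mixFFAt (toSite (ctrOff 4 Lc)) Lc κ u ρ' w
          + (2 : ℝ) • comp (diagK (ctGen 3 α Lc κ u)) (hessFFAt (toSite (ctrOff 4 Lc)) Lc ρ' w)
          + (2 * (if ρ' = α then linKerAt (toSite (ctrOff 4 Lc)) Lc ρ' w (κ, u) else 0)) • hessFFAt (toSite (ctrOff 4 Lc)) Lc ρ' w))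
      x z (Sum.inl β) (Sum.inl β')
      = reflSign α κ * reflSign α ρ' * (reflSign α β * reflSign α β' *
          (mixKerAt (toSite (ctrOff 4 Lc)) Lc ρ' w (κ, u) (β, bref α β x) (β', bref α β' z)
            + 2 * (if bref α β x = u ∧ β = κ ∧ κ = α then -1 else 0)
                * hessKerAt (toSite (ctrOff 4 Lc)) Lc ρ' w (β, bref α β x) (β', bref α β' z)
            + 2 * (if ρ' = α then linKerAt (toSite (ctrOff 4 Lc)) Lc ρ' w (κ, u) else 0)
                * hessKerAt (toSite (ctrOff 4 Lc)) Lc ρ' w (β, bref α β x) (β', bref α β' z))) := by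
  simp only [Pi.smul_apply, Pi.add_apply, smul_eq_mul, refK_apply, Φ_r_inl, Φ_s_inl, comp_diagK_left, ctGen_inl, mixFFAt_inl_inl,
    hessFFAt_inl_inl]
  ring


/-- [folklore] THE `ℚ`-TABLE READING (an3-g33's RE-SCOPE (b)): `mixKerAt` is the bare cast of node 12b's `tTab` with the background bond LAST —
`mixKerAt ρ L μ y g f f′ = (tTab ρ L μ y f f′ g : ℝ)` (by `rfl`), so the bond law may be closed over `ℚ` and cast once. -/
theorem mixKerAt_eq_tTab_cast {d : ℕ} (ρ : Fin d → ℤ) (L : ℕ) (μ : Fin d) (y : Fin d → ℤ) (g f f' : AveragingHessianKernels.Bond d) :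
    mixKerAt ρ L μ y g f f' = (AveragingMixedJetTables.tTab ρ L μ y f f' g : ℝ) := rfl

open Classical in
/-- [folklore] **MATRIX LAW ⟺ BOND LAW**: MX2's hypothesis `hM_an1` (an1's packed table-level mixed reflection law) is EQUIVALENT to the displayed
scalar identity on the field–field entries (both tables are field–field supported, so the other entries of both sides vanish). -/
theorem tableLaw_iff_bondLaw :
    (∀ (α κ : Fin 4) (u : Fin 4 → ℤ) (ρ' : Fin 4) (w : Fin 4 → ℤ),
      mixFFAt (toSite (ctrOff 4 Lc)) Lc κ (bref α κ u) ρ' (bref α ρ' w) =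
        (reflSign α κ * reflSign α ρ') • refK (Φ Lc α)
          (mixFFAt (toSite (ctrOff 4 Lc)) Lc κ u ρ' w
            + (2 : ℝ) • comp (diagK (ctGen 3 α Lc κ u)) (hessFFAt (toSite (ctrOff 4 Lc)) Lc ρ' w)
            + (2 * (if ρ' = α then linKerAt (toSite (ctrOff 4 Lc)) Lc ρ' w (κ, u) else 0)) • hessFFAt (toSite (ctrOff 4 Lc)) Lc ρ' w))
    ↔ (∀ (α κ : Fin 4) (u : Fin 4 → ℤ) (ρ' : Fin 4) (w : Fin 4 → ℤ) (β : Fin 4) (x : Fin 4 → ℤ) (β' : Fin 4) (z : Fin 4 → ℤ),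
      mixKerAt (toSite (ctrOff 4 Lc)) Lc ρ' (bref α ρ' w) (κ, bref α κ u) (β, x) (β', z)
        = reflSign α κ * reflSign α ρ' * (reflSign α β * reflSign α β' *
            (mixKerAt (toSite (ctrOff 4 Lc)) Lc ρ' w (κ, u) (β, bref α β x) (β', bref α β' z)
              + 2 * (if bref α β x = u ∧ β = κ ∧ κ = α then -1 else 0)
                  * hessKerAt (toSite (ctrOff 4 Lc)) Lc ρ' w (β, bref α β x) (β', bref α β' z)
              + 2 * (if ρ' = α then linKerAt (toSite (ctrOff 4 Lc)) Lc ρ' w (κ, u) else 0)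
                  * hessKerAt (toSite (ctrOff 4 Lc)) Lc ρ' w (β, bref α β x) (β', bref α β' z)))) := by
  constructor
  · intro h α κ u ρ' w β x β' z
    have e := congrArg (fun K : MKer 4 (Fib 3) => K x z (Sum.inl β) (Sum.inl β')) (h α κ u ρ' w)
    simp only [mixFFAt_inl_inl] at e
    rw [e]
    exact tableLaw_apply_inl_inl α κ u ρ' w β x β' z
  · intro h α κ u ρ' w
    funext x z a b
    rcases a with β | m
    · rcases b with β' | m'
      · rw [mixFFAt_inl_inl, tableLaw_apply_inl_inl, h]
      · -- (inl, inr): both sides vanish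
        simp only [Pi.smul_apply, Pi.add_apply, smul_eq_mul, refK_apply, comp_diagK_left, mixFFAt_inl_inr, hessFFAt_inl_inr,
          mul_zero, add_zero]
    · -- (inr, ·): both sides vanish
      simp only [Pi.smul_apply, Pi.add_apply, smul_eq_mul, refK_apply, comp_diagK_left, mixFFAt_inr, hessFFAt_inr, mul_zero, add_zero]

open Classical in
/-- [folklore] **BOND LAW ⟹ THE THREE MIXED BINDERS** of `SpineRooted.…_of_an1_letters₀` at the Λ-lock value `cΛ·Lc⁴ = 2` (MX2), with
`RM₀ := RMof Lc cΛ`.  CONDITIONAL on the bond-level law (hypothesis `hB`; the AVG-LETTERS chain's M3∕M4 target). -/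
theorem mixedBinders_of_bondLaw [NeZero Lc] (hLc : Odd Lc) {cΛ : ℝ} (hΛ : cΛ * (Lc : ℝ) ^ 4 = 2)
    (hB : ∀ (α κ : Fin 4) (u : Fin 4 → ℤ) (ρ' : Fin 4) (w : Fin 4 → ℤ) (β : Fin 4) (x : Fin 4 → ℤ) (β' : Fin 4) (z : Fin 4 → ℤ),
      mixKerAt (toSite (ctrOff 4 Lc)) Lc ρ' (bref α ρ' w) (κ, bref α κ u) (β, x) (β', z)
        = reflSign α κ * reflSign α ρ' * (reflSign α β * reflSign α β' *
            (mixKerAt (toSite (ctrOff 4 Lc)) Lc ρ' w (κ, u) (β, bref α β x) (β', bref α β' z)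
              + 2 * (if bref α β x = u ∧ β = κ ∧ κ = α then -1 else 0)
                  * hessKerAt (toSite (ctrOff 4 Lc)) Lc ρ' w (β, bref α β x) (β', bref α β' z)
              + 2 * (if ρ' = α then linKerAt (toSite (ctrOff 4 Lc)) Lc ρ' w (κ, u) else 0)
                  * hessKerAt (toSite (ctrOff 4 Lc)) Lc ρ' w (β, bref α β x) (β', bref α β' z)))) :
    MixedPrim Lc (toSite (ctrOff 4 Lc)) cΛ (mixFFAt (toSite (ctrOff 4 Lc)) Lc) (RMof Lc cΛ)
      ∧ (∀ α : Fin 4, ∃ C δ : ℝ, 0 < δ ∧ LocStencilFM Lc (RMof Lc cΛ α) C δ)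
      ∧ (∀ (α κ : Fin 4) (u : Fin 4 → ℤ) (ρ' : Fin 4) (w : Fin 4 → ℤ), trK (RMof Lc cΛ α κ u ρ' w) = -sgnK (RMof Lc cΛ α κ u ρ' w)) :=
  mixedBinders_of_tableLaw hLc hΛ (tableLaw_iff_bondLaw.2 hB)

end

end Summit.QuantumFields.BalabanUV.Beta.MixedLetterUnpacking
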